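import Summits.Ventures.GridStability.Models.InverterNetworkLinearisation
import Summits.Ventures.GridStability.Models.WSCC9LosslessLFF
import Literature.LinearAlgebra.Matrix.SylvesterCriterion

/-!
# GridStability/Models/WSCC9LosslessLinearisation — FIRST INSTANCE of the N-independent small-signal lane: the WSCC9 lossless uniform-λ variant (model-1's LFF-P1 object), read also as a 3-unit common-filter droop microgrid

Cell `gridfusion` (LADDER-GRIDFUSION, G3-ss / apex line; seat gridfusion-model-3 (g5)). The lane of
`Models/UniformDampingSpectrum.lean` (p496499) + `Models/InverterNetworkLinearisation.lean` applied to a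
typed object OF RECORD: model-1's `WSCC9.postB_relL` (`Models/WSCC9LosslessLFF.lean`, lead P1 2026-08-27
01:19:25Z: the printed post-fault 9-bus reduced network with transfer conductances dropped, h12 data
f8499ea36c23561e, block-C circle points; MODELLED MV-2L synthetic + MV-RD + MV-λ + MV-h12) as the
uniformly damped classical model `postB_relL.toModelRel λ a′` (`D_i = λ M_i`, any `λ`, any common
acceleration `a′`). EVERYTHING EXACT, NO SOLVER, NO kit:

* §0 `posDef_fin_three_of_minors` — the `3 × 3` case of the tree's Sylvester criterion
  (`Literature.LinearAlgebra.Matrix.posDef_of_leadingMinors_pos`) in entry form.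
* §1 (generic, model-1's A1 data `RecastData`): the EXACT rational synchronising Laplacian `PeJacQ`
  (`L_ij = −C_ij(c_ic_j + s_is_j) + D_ij(s_ic_j − c_is_j)`, `L_ii = Σ_{k≠i} …`) with the bridge
  `PeJac_toModelRel_angleOf`: the real Jacobian block `L(δ*)` of `toModelRel λ a′` at the equilibrium angles
  `angleOf` IS `PeJacQ` cast to `ℝ` (cos/sin of differences of `angleOf` are the rational circle data).
* §2 `DroopMicrogrid.ofClassicalUniform` — every uniformly damped classical model IS a frozen-voltage
  droop microgrid with common filter constant `τ = 1/λ`, gains `λ^p_i = 1/(λ M_i)` (kernel identity of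
  records, `toClassicalSwing_ofClassicalUniform`); so every sentence below reads verbatim on that
  3-inverter droop microgrid MODEL (N2, p464230) — a reading, not a second physical claim.
* §3 THE INSTANCE: `postB_relL_PeJacQ` (the 3 × 3 Laplacian in closed rational form, `decide`);
  the pencil certificate `linCertQ = L − 41·diag(M) + 1000·M Mᵀ ≻ 0` (three leading minors by `decide`,
  `linCert_posDef`); hence for EVERY damping ratio `λ > 0`:
  - `postB_relL_eig_re_lt` — `2r < λ ∧ λr − r² < 41` ⇒ every eigenpair of the Jacobian at the
    equilibrium off the synchronous mode has `Re z < −r`;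
  - `postB_relL_eig_re_eq` — `λ² ≤ 164` ⇒ `Re z = −λ/2` EXACTLY (underdamped: the two electromechanical
    mode pairs, pencil eigenvalues `ν ≈ 41.24, 172.9 (rad/s)²` i.e. `1.02 Hz, 2.09 Hz` undamped (float,
    informative only; certified: `ν > 41`), share the decay rate `λ/2`); at the `λ = 1/10` of record
    (MV-λ) `Re z = −1/20` (`postB_relL_eig_re_eq_tenth`);
  - `postB_relL_eig_sync` + `postB_relL_ker_iff` — the synchronous mode is exactly the uniform angle
    shift `x₀ = x₁ = x₂`, with `z ∈ {0, −λ}`;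
  - droop reading `postB_relL_eig_rate_droop30`: common filter `τ = 1/30 s` (`λ = 30`, OVERDAMPED since
    `30² > 4·172.9`): certified rate `7/5 s⁻¹` for every non-synchronous mode (`30·(7/5) − (7/5)² = 40.04 < 41`).
  - `postB_relL_hasFDerivAt_field` — the Jacobian is the derivative of the typed field (kernel fact).

THREE COLUMNS. CERTIFIED (kernel, this file): statements about the MATRIX `J(δ*)` of the MODEL
`postB_relL.toModelRel λ a′` (and of its droop reading); «small-signal» = spectrum of `J`; nothing about
the nonlinear flow. MODELLED: MV-2L synthetic + MV-RD + MV-λ + MV-h12 (a lossless VARIANT of the printed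
9-bus reduction — NOT the WSCC 9-bus system; [cite: SauerPai1998, §6.10] uniform damping; droop reading
[cite: SchifferEtAl2014, Remark 3.3], [cite: KunduEtAl2019, eqs. (4a)–(4b), (5a)]). VALIDATED: none (no
printed spectrum for this variant; the float frequencies above are our own arithmetic, informative).
No sentence of this file says a grid, a microgrid or a converter is stable.
-/

noncomputable section

open Real Matrix Finset
open scoped ComplexOrder

namespace Summit.Ventures.GridStability.Models

/-! ## §0 Sylvester's criterion, `3 × 3`, entry form -/

/-- A real symmetric `3 × 3` matrix with positive leading principal minors `S₀₀`,
`S₀₀S₁₁ − S₀₁S₁₀`, `det S` is positive definite (the tree's Sylvester criterion, HJ Thm 7.2.5 (b)).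
[cite: HornJohnson2013, Thm 7.2.5 (b), p0538] -/
theorem posDef_fin_three_of_minors {S : Matrix (Fin 3) (Fin 3) ℝ} (hS : S.IsSymm) (h1 : 0 < S 0 0)
    (h2 : 0 < S 0 0 * S 1 1 - S 0 1 * S 1 0) (h3 : 0 < S.det) : S.PosDef := by
  refine Literature.LinearAlgebra.Matrix.posDef_of_leadingMinors_pos
    (Matrix.isHermitian_iff_isSymm.2 hS) fun k hk => ?_
  interval_cases k
  · rw [Matrix.det_isEmpty]
    exact zero_lt_one
  · rw [Matrix.det_fin_one]
    simpa using h1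
  · rw [Matrix.det_fin_two]
    simpa [Matrix.submatrix_apply, Fin.castLE] using h2
  · simpa [Fin.castLE_rfl] using h3

/-! ## §1 The exact synchronising Laplacian of A1 data (`RecastData`) -/

namespace RecastData

variable {n : ℕ} (d : RecastData n)

/-- Exact synchronising coefficient at the A1 equilibrium: `a_ij = C_ij (c_ic_j + s_is_j) − D_ij (s_ic_j − c_is_j)`
(`= C_ij cos δ*_ij − D_ij sin δ*_ij`, rational). [cite: SauerPai1998, §7.9.1 (7.212)–(7.214)] -/
def syncCoefQ (i j : Fin (n + 1)) : ℚ := d.Cc i j * d.cd i j - d.Dc i j * d.sd i j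

/-- The exact rational synchronising Laplacian `L(δ*)` (diagonal as a kernel-friendly `List` sum, cf.
`Pprime`): `L_ii = Σ_{k ≠ i} a_ik`, `L_ij = −a_ij`. [folklore] -/
def PeJacQ : Matrix (Fin (n + 1)) (Fin (n + 1)) ℚ := fun i j =>
  if j = i then (((List.finRange (n + 1)).filter (· ≠ i)).map (d.syncCoefQ i)).sum else -d.syncCoefQ i j

/-- `PeJacQ` with the diagonal as a `Finset` sum. [folklore] -/
theorem PeJacQ_apply (i j : Fin (n + 1)) :
    d.PeJacQ i j = if j = i then ∑ k ∈ univ.erase i, d.syncCoefQ i k else -d.syncCoefQ i j := by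
  unfold PeJacQ
  split_ifs with h
  · rw [← List.sum_toFinset _ ((List.nodup_finRange _).filter _)]
    congr 1
    ext k
    simp [Finset.mem_erase, ne_comm]
  · rfl

/-- The inertias of `toModelRel` are the rational `M_i`. [folklore] -/
theorem toModelRel_M (lam : ℚ) (a : ℝ) (i : Fin (n + 1)) : (d.toModelRel lam a).M i = (d.M i : ℝ) := rfl

/-- `toModelRel λ a′` has UNIFORM damping ratio `λ`: `D_i = λ·M_i`. [cite: SauerPai1998, §6.10] -/
theorem toModelRel_uniformDamping (lam : ℚ) (a : ℝ) (i : Fin (n + 1)) :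
    (d.toModelRel lam a).D i = (lam : ℝ) * (d.toModelRel lam a).M i := rfl

/-- Lossless data give a lossless real model. [folklore] -/
theorem isLossless_toModelRel (hG : ∀ i j, i ≠ j → d.G i j = 0) (lam : ℚ) (a : ℝ) :
    (d.toModelRel lam a).IsLossless := by
  intro i j hij
  simp [toModelRel, hG i j hij]

/-- Reciprocal data give a reciprocal real model. [folklore] -/
theorem B_symm_toModelRel (hB : ∀ i j, d.B i j = d.B j i) (lam : ℚ) (a : ℝ) (i j : Fin (n + 1)) :
    (d.toModelRel lam a).B i j = (d.toModelRel lam a).B j i := by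
  simp [toModelRel, hB i j]

/-- **Bridge, coefficient level**: at the angles `angleOf` of exact circle data, the real synchronising
coefficient of `toModelRel λ a′` IS the rational `syncCoefQ` (angle-difference formulas +
`cos_angleOf`/`sin_angleOf`). [folklore] -/
theorem syncCoef_toModelRel_angleOf (hcirc : ∀ i, d.s i ^ 2 + d.c i ^ 2 = 1) (lam : ℚ) (a : ℝ)
    (i j : Fin (n + 1)) :
    (d.toModelRel lam a).syncCoef d.angleOf i j = (d.syncCoefQ i j : ℝ) := by
  simp only [ClassicalSwing.syncCoef, ClassicalSwing.Ccoef, ClassicalSwing.Dcoef, toModelRel, syncCoefQ,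
    Cc, Dc, cd, sd, cos_sub, sin_sub, d.cos_angleOf (hcirc i), d.cos_angleOf (hcirc j),
    d.sin_angleOf (hcirc i), d.sin_angleOf (hcirc j)]
  push_cast
  ring

/-- **Bridge, matrix level**: `L(δ*)` of `toModelRel λ a′` at `angleOf` IS `PeJacQ` cast to `ℝ`. [folklore] -/
theorem PeJac_toModelRel_angleOf (hcirc : ∀ i, d.s i ^ 2 + d.c i ^ 2 = 1) (lam : ℚ) (a : ℝ) :
    (d.toModelRel lam a).PeJac d.angleOf = d.PeJacQ.map ((↑) : ℚ → ℝ) := by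
  ext i j
  rw [Matrix.map_apply, PeJacQ_apply]
  simp only [ClassicalSwing.PeJac, d.syncCoef_toModelRel_angleOf hcirc]
  split_ifs <;> push_cast <;> rfl

end RecastData

/-! ## §2 The droop reading: every uniformly damped classical model is a common-filter droop microgrid -/

namespace DroopMicrogrid

variable {n : ℕ}

/-- **Every uniformly damped classical model IS a common-filter droop microgrid at frozen voltages**
(the converse reading of `toClassicalSwing_uniformDamping`): filter time constants `τ_Pi = τ_Qi = 1/d`,
P–ω gains `λ^p_i = 1/(d M_i)` (so `τ_Pi/λ^p_i = M_i`, `1/λ^p_i = d M_i = D_i`), `λ^q = 0`, set-points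
`P^set = P`, `Q^set = 0`, nominal voltages `v⁰ = E`, same `G, B`. MODELLED: an identification of typed vector
fields ([cite: SchifferEtAl2014, Remark 3.3] network-wide); nothing physical is asserted. -/
def ofClassicalUniform (p : ClassicalSwing n) (d : ℝ) : DroopMicrogrid n where
  τP := fun _ => 1 / d
  τQ := fun _ => 1 / d
  kP := fun i => 1 / (d * p.M i)
  kQ := fun _ => 0
  Pset := p.P
  Qset := fun _ => 0
  Vset := p.E
  G := p.G
  B := p.B

/-- The identification is exact: `(ofClassicalUniform p d).toClassicalSwing E = p` when `D_i = d·M_i`,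
`M_i ≠ 0`, `d ≠ 0`; hence `freqField_eq_field` makes the frozen-voltage droop field of
`ofClassicalUniform p d` literally `p.field`. [cite: SchifferEtAl2014, Remark 3.3] -/
theorem toClassicalSwing_ofClassicalUniform (p : ClassicalSwing n) {d : ℝ} (hD : ∀ i, p.D i = d * p.M i)
    (hM : ∀ i, p.M i ≠ 0) (hd : d ≠ 0) : (ofClassicalUniform p d).toClassicalSwing p.E = p := by
  obtain ⟨M, D, P, E, G, B⟩ := p
  simp only [ofClassicalUniform, toClassicalSwing, ClassicalSwing.mk.injEq, and_true]
  simp only at hD hM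
  constructor
  · funext i
    field_simp [hM i]
  · funext i
    rw [hD i]
    field_simp

/-- The frozen-voltage droop field of the reading IS the classical field. [cite: SchifferEtAl2014, Remark 3.3] -/
theorem freqField_ofClassicalUniform (p : ClassicalSwing n) {d : ℝ} (hD : ∀ i, p.D i = d * p.M i)
    (hM : ∀ i, p.M i ≠ 0) (hd : d ≠ 0) : (ofClassicalUniform p d).freqField p.E = p.field := by
  have hk : ∀ i, (ofClassicalUniform p d).kP i ≠ 0 := fun i => by simp [ofClassicalUniform, hM i, hd]
  have hτ : ∀ i, (ofClassicalUniform p d).τP i ≠ 0 := fun i => by simp [ofClassicalUniform, hd]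
  funext x
  rw [freqField_eq_field _ hk hτ, toClassicalSwing_ofClassicalUniform p hD hM hd]

end DroopMicrogrid

/-! ## §3 The instance: WSCC9 lossless uniform-λ variant `postB_relL.toModelRel λ a′` -/

namespace WSCC9

open RecastData

/-- **The exact synchronising Laplacian `L(δ*)` of the lossless 9-bus variant at its block-C equilibrium**
(computed IN LEAN from model-4's h12 data; floats ≈ `[[1.667, −0.618, −1.049], [−0.618, 1.888, −1.270],
[−1.049, −1.270, 2.319]]`). MODELLED: MV-2L synthetic + MV-RD + MV-h12. [folklore] -/
theorem postB_relL_PeJacQ : postB_relL.PeJacQ =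
    !![(1123004255355400137513514701871 : ℚ)/673830216486427361300000000000,
        (-99478023251031598173 : ℚ)/160991417800000000000,
        (-1755717428695015428709 : ℚ)/1674201583400000000000;
      (-99478023251031598173 : ℚ)/160991417800000000000,
        (1272284927057657308375039728939 : ℚ)/673830216486427361300000000000,
        (-1711838533913419030026733722237 : ℚ)/1347660432972854722600000000000;
      (-1755717428695015428709 : ℚ)/1674201583400000000000,
        (-1711838533913419030026733722237 : ℚ)/1347660432972854722600000000000,
        (1562557862211161859165208695169 : ℚ)/673830216486427361300000000000] := by
  decide +kernel

/-- **The pencil certificate matrix** `S = L(δ*) − 41·diag(M) + 1000·M Mᵀ` (exact, rational):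
`ν₀ = 41 (rad/s)²` just below the smaller non-synchronous pencil eigenvalue (float ≈ 41.24), `β = 1000`.
[folklore] -/
def linCertQ : Matrix (Fin 3) (Fin 3) ℚ :=
  postB_relL.PeJacQ - (41 : ℚ) • Matrix.diagonal postB_relL.M
    + (1000 : ℚ) • Matrix.vecMulVec postB_relL.M postB_relL.M

/-- `S` is symmetric. [folklore] -/
theorem linCertQ_isSymm : linCertQ.IsSymm := by
  unfold Matrix.IsSymm linCertQ
  rw [postB_relL_PeJacQ]
  decide +kernel

/-- The three leading principal minors of `S` are positive (floats ≈ 12.25, 6.95, 0.292). [folklore] -/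
theorem linCertQ_minors :
    0 < linCertQ 0 0 ∧ 0 < linCertQ 0 0 * linCertQ 1 1 - linCertQ 0 1 * linCertQ 1 0 ∧ 0 < linCertQ.det := by
  rw [Matrix.det_fin_three]
  unfold linCertQ
  rw [postB_relL_PeJacQ]
  refine ⟨by decide +kernel, by decide +kernel, by decide +kernel⟩

/-- The inertias of the variant are positive (`M = (1182/9425, 64/1885, 301/18850)`). [folklore] -/
theorem postB_relL_M_pos (lam : ℚ) (a : ℝ) : ∀ i, 0 < (postB_relL.toModelRel lam a).M i := by
  intro i
  rw [toModelRel_M]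
  have h : ∀ i : Fin 3, 0 < postB_relL.M i := by decide +kernel
  exact_mod_cast h i

/-- **The pencil certificate holds for the real model**: `L(δ*) − 41·diag(M) + 1000·M Mᵀ ≻ 0` for
`postB_relL.toModelRel λ a′` at `angleOf` (any `λ`, `a′`) — Sylvester on the exact rational minors. CERTIFIED.
MODELLED: MV-2L synthetic + MV-RD + MV-h12. [folklore] -/
theorem linCert_posDef (lam : ℚ) (a : ℝ) :
    ((postB_relL.toModelRel lam a).PeJac postB_relL.angleOf
      - (41 : ℝ) • Matrix.diagonal (postB_relL.toModelRel lam a).M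
      + (1000 : ℝ) • Matrix.vecMulVec (postB_relL.toModelRel lam a).M
          (postB_relL.toModelRel lam a).M).PosDef := by
  have hmat : (postB_relL.toModelRel lam a).PeJac postB_relL.angleOf
      - (41 : ℝ) • Matrix.diagonal (postB_relL.toModelRel lam a).M
      + (1000 : ℝ) • Matrix.vecMulVec (postB_relL.toModelRel lam a).M (postB_relL.toModelRel lam a).M
      = linCertQ.map ((↑) : ℚ → ℝ) := by
    rw [postB_relL.PeJac_toModelRel_angleOf postB_relL_circle.1]
    ext i j
    simp only [linCertQ, Matrix.add_apply, Matrix.sub_apply, Matrix.smul_apply, Matrix.map_apply,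
      Matrix.diagonal_apply, Matrix.vecMulVec_apply, toModelRel_M, smul_eq_mul]
    split_ifs <;> push_cast <;> ring
  rw [hmat]
  obtain ⟨h1, h2, h3⟩ := linCertQ_minors
  refine posDef_fin_three_of_minors ?_ ?_ ?_ ?_
  · have hs := linCertQ_isSymm
    unfold Matrix.IsSymm at hs ⊢
    rw [← Matrix.transpose_map, hs]
  · simp only [Matrix.map_apply]
    exact_mod_cast h1
  · simp only [Matrix.map_apply]
    exact_mod_cast h2
  · rw [Matrix.det_fin_three] at h3 ⊢
    simp only [Matrix.map_apply]
    exact_mod_cast h3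

/-- **Linearisation of the variant (kernel fact)**: at every state the field of `postB_relL.toModelRel λ a′`
has Fréchet derivative `jacCLM δ` (= the block matrix `jacMatrix δ`, `ClassicalSwing.jacCLM_eq_mulVec`).
MODELLED: MV-2L synthetic + MV-RD + MV-λ + MV-h12. [folklore] -/
theorem postB_relL_hasFDerivAt_field (lam : ℚ) (a : ℝ) (x : ClassicalSwing.State 3) :
    HasFDerivAt (postB_relL.toModelRel lam a).field ((postB_relL.toModelRel lam a).jacCLM x.1) x :=
  (postB_relL.toModelRel lam a).hasFDerivAt_field x

/-- **CERTIFIED small-signal decay rate, every uniform damping ratio `λ > 0`.** For the Jacobian `J(δ*)` of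
`postB_relL.toModelRel λ a′` at the equilibrium angles: if `2r < λ` and `λr − r² < 41` then every complex
eigenpair `(z, [x; y])` is synchronous (`L(δ*) x = 0`, i.e. `x₀ = x₁ = x₂`, `postB_relL_ker_iff`) or has
`Re z < −r`. One 3 × 3 exact PSD certificate (`linCert_posDef`), no SDP. CERTIFIED (about the matrix
`J(δ*)`); MODELLED: MV-2L synthetic + MV-RD + MV-λ + MV-h12 [cite: SauerPai1998, §6.10]. No stability
sentence. -/
theorem postB_relL_eig_re_lt (lam : ℚ) (a : ℝ) {r : ℝ} (h1 : 2 * r < lam)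
    (h2 : (lam : ℝ) * r - r ^ 2 < 41) {z : ℂ} {w : Fin 3 ⊕ Fin 3 → ℂ} (hw : w ≠ 0)
    (hJ : ((postB_relL.toModelRel lam a).jacMatrix postB_relL.angleOf).map ((↑) : ℝ → ℂ) *ᵥ w = z • w) :
    ((postB_relL.toModelRel lam a).PeJac postB_relL.angleOf).map ((↑) : ℝ → ℂ) *ᵥ (w ∘ Sum.inl) = 0 ∨
      z.re < -r :=
  (postB_relL.toModelRel lam a).eig_re_lt_neg_of_uniformDamping (postB_relL_M_pos lam a)
    (postB_relL.toModelRel_uniformDamping lam a)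
    (postB_relL.isLossless_toModelRel postB_relL_transferConductance_eq_zero lam a)
    (postB_relL.B_symm_toModelRel postB_relL_B_symm lam a) postB_relL.angleOf (linCert_posDef lam a)
    (by linarith) (by linarith) hw hJ

/-- **Underdamped regime `λ² ≤ 164`: every non-synchronous mode has `Re z = −λ/2` EXACTLY** (the two
electromechanical mode pairs of the MODEL share the decay rate `λ/2`; certified `ν > 41 ≥ λ²/4`).
CERTIFIED (matrix statement); MODELLED: MV-2L synthetic + MV-RD + MV-λ + MV-h12. No stability sentence. -/
theorem postB_relL_eig_re_eq (lam : ℚ) (a : ℝ) (hlam : (lam : ℝ) ^ 2 ≤ 164) {z : ℂ}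
    {w : Fin 3 ⊕ Fin 3 → ℂ} (hw : w ≠ 0)
    (hJ : ((postB_relL.toModelRel lam a).jacMatrix postB_relL.angleOf).map ((↑) : ℝ → ℂ) *ᵥ w = z • w) :
    ((postB_relL.toModelRel lam a).PeJac postB_relL.angleOf).map ((↑) : ℝ → ℂ) *ᵥ (w ∘ Sum.inl) = 0 ∨
      z.re = -((lam : ℝ) / 2) :=
  (postB_relL.toModelRel lam a).eig_re_eq_of_uniformDamping (postB_relL_M_pos lam a)
    (postB_relL.toModelRel_uniformDamping lam a)
    (postB_relL.isLossless_toModelRel postB_relL_transferConductance_eq_zero lam a)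
    (postB_relL.B_symm_toModelRel postB_relL_B_symm lam a) postB_relL.angleOf (linCert_posDef lam a)
    (by linarith) hw hJ

/-- At the uniform damping ratio OF RECORD `λ = 1/10 s⁻¹` («WSCC9-postB-λ», MV-λ): every non-synchronous
mode of the linearisation has `Re z = −1/20 s⁻¹` exactly. CERTIFIED (matrix statement); MODELLED: MV-2L
synthetic + MV-RD + MV-λ + MV-h12. No stability sentence. -/
theorem postB_relL_eig_re_eq_tenth (a : ℝ) {z : ℂ} {w : Fin 3 ⊕ Fin 3 → ℂ} (hw : w ≠ 0)
    (hJ : ((postB_relL.toModelRel (1 / 10) a).jacMatrix postB_relL.angleOf).map ((↑) : ℝ → ℂ) *ᵥ w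
      = z • w) :
    ((postB_relL.toModelRel (1 / 10) a).PeJac postB_relL.angleOf).map ((↑) : ℝ → ℂ) *ᵥ (w ∘ Sum.inl) = 0
      ∨ z.re = -(1 / 20) := by
  have h := postB_relL_eig_re_eq (1 / 10) a (by push_cast; norm_num) hw hJ
  push_cast at h
  norm_num at h
  exact h

/-- **The synchronous mode**: an eigenpair whose angle part is annihilated by `L(δ*)` has `z = 0` (the
rotational symmetry) or `z = −λ`. [folklore] -/
theorem postB_relL_eig_sync (lam : ℚ) (a : ℝ) {z : ℂ} {w : Fin 3 ⊕ Fin 3 → ℂ} (hw : w ≠ 0)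
    (hJ : ((postB_relL.toModelRel lam a).jacMatrix postB_relL.angleOf).map ((↑) : ℝ → ℂ) *ᵥ w = z • w)
    (hL : ((postB_relL.toModelRel lam a).PeJac postB_relL.angleOf).map ((↑) : ℝ → ℂ) *ᵥ (w ∘ Sum.inl)
      = 0) : z = 0 ∨ z = -(lam : ℂ) := by
  have h := (postB_relL.toModelRel lam a).eig_sync_of_uniformDamping
    (postB_relL.toModelRel_uniformDamping lam a) (fun i => (postB_relL_M_pos lam a i).ne')
    postB_relL.angleOf hw hJ hL
  simpa using h

/-- **The kernel of `L(δ*)` is the uniform angle shift** (connected network, positive synchronising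
coefficients): `L(δ*) x = 0 ⟺ x₀ = x₁ = x₂` (complex `x`). [folklore] -/
theorem postB_relL_ker_iff (lam : ℚ) (a : ℝ) (x : Fin 3 → ℂ) :
    ((postB_relL.toModelRel lam a).PeJac postB_relL.angleOf).map ((↑) : ℝ → ℂ) *ᵥ x = 0 ↔
      (x 0 = x 1 ∧ x 1 = x 2) := by
  rw [postB_relL.PeJac_toModelRel_angleOf postB_relL_circle.1, Matrix.map_map, postB_relL_PeJacQ]
  have hc : ((↑) : ℝ → ℂ) ∘ ((↑) : ℚ → ℝ) = ((↑) : ℚ → ℂ) := by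
    funext q; simp
  rw [hc]
  constructor
  · intro h
    have h0 := congr_fun h 0
    have h1 := congr_fun h 1
    simp [Matrix.mulVec, dotProduct, Fin.sum_univ_three] at h0 h1
    have hv : x 1 - x 2 = 0 := by
      have : ((1004336819359188829153869311270497906918822919101109097379719 : ℚ) /
          363237728520116451282231727537024590152000000000000000000000 : ℂ) * (x 1 - x 2) = 0 := by
        push_cast
        linear_combination ((99478023251031598173 : ℂ) / 160991417800000000000) * h0
          + ((99478023251031598173 : ℂ) / 160991417800000000000
              + (1755717428695015428709 : ℂ) / 1674201583400000000000) * h1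
      rcases mul_eq_zero.1 this with hK | hK
      · norm_num at hK
      · exact hK
    have hu : x 0 - x 1 = 0 := by
      have hv' : x 2 = x 1 := by linear_combination -hv
      rw [hv'] at h0
      have : (((99478023251031598173 : ℚ) / 160991417800000000000
          + (1755717428695015428709 : ℚ) / 1674201583400000000000 : ℚ) : ℂ) * (x 0 - x 1) = 0 := by
        push_cast
        linear_combination h0
      rcases mul_eq_zero.1 this with hK | hK
      · norm_num at hK
      · exact hK
    constructor
    · linear_combination hu
    · linear_combination hv
  · rintro ⟨h01, h12⟩
    funext i
    fin_cases i <;> simp [Matrix.mulVec, dotProduct, Fin.sum_univ_three, h01, h12] <;> ring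

/-- **The droop reading of the variant**: `postB_relL.toModelRel λ a′` IS the frozen-voltage field of the
3-unit droop microgrid `ofClassicalUniform _ λ` (common filter `τ = 1/λ`, gains `1/(λ M_i)`, voltages `E`,
the variant's lossless reciprocal network); so every theorem of this section reads verbatim on that
droop-microgrid MODEL (N2). MODELLED reading [cite: SchifferEtAl2014, Remark 3.3]
[cite: KunduEtAl2019, eqs. (4a)–(4b), (5a)]; nothing physical asserted. -/
theorem postB_relL_droopReading (lam : ℚ) (a : ℝ) (hlam : lam ≠ 0) :
    (DroopMicrogrid.ofClassicalUniform (postB_relL.toModelRel lam a) lam).freqField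
        (postB_relL.toModelRel lam a).E = (postB_relL.toModelRel lam a).field :=
  DroopMicrogrid.freqField_ofClassicalUniform _ (postB_relL.toModelRel_uniformDamping lam a)
    (fun i => (postB_relL_M_pos lam a i).ne') (by exact_mod_cast hlam)

/-- **Droop-reading corollary at a realistic common filter constant `τ = 1/30 s` (`λ = 30 s⁻¹`, the
OVERDAMPED regime `30² > 4ν`)**: certified decay rate `7/5 s⁻¹` for every non-synchronous mode of the
linearisation (`2·(7/5) < 30`, `30·(7/5) − (7/5)² = 1001/25 < 41`). CERTIFIED (matrix statement);
MODELLED: the droop reading of MV-2L synthetic + MV-RD + MV-h12 with `τ = 1/30` (gains `1/(30 M_i)` are a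
CONSTRUCTION, not printed converter data). No stability sentence. -/
theorem postB_relL_eig_rate_droop30 (a : ℝ) {z : ℂ} {w : Fin 3 ⊕ Fin 3 → ℂ} (hw : w ≠ 0)
    (hJ : ((postB_relL.toModelRel 30 a).jacMatrix postB_relL.angleOf).map ((↑) : ℝ → ℂ) *ᵥ w = z • w) :
    ((postB_relL.toModelRel 30 a).PeJac postB_relL.angleOf).map ((↑) : ℝ → ℂ) *ᵥ (w ∘ Sum.inl) = 0 ∨
      z.re < -(7 / 5) :=
  postB_relL_eig_re_lt 30 a (by push_cast; norm_num) (by push_cast; norm_num) hw hJ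

end WSCC9

end Summit.Ventures.GridStability.Models

end
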